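import Summits.BirchSwinnertonDyer.Rank1Residual.X12.O11.RamifiedStrictDescentAtThreeRegimeT
import Summits.BirchSwinnertonDyer.Rank1Residual.X12.O11.StrictSelmerIndexModTorsionRat
import HarnessLib

/-!
# O11 at `p = 3`, companion VII-b — REGIME T of route `PrintCFram` (item stmt-BirchSwinnertonDyer-20699):
# the three TORSION-ALLOWING inputs (R-tors)₃ᵀ, (R-ctrl)₃ᵀ♯, (R-EU)₃ᵀ typed with both defects `d₀`,
# `d(T₀)` DISPLAYED and the generators' levels `ñ, ñ'` MODULO TORSION, and the PROVED consumer
# `⟹ BSD(W, 3)` (cell `bsd-print-cfram`, D-0131 (2), typer `ty2` gen 3; PLAN v5 ask (δ)(iii)–(iv);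
# NOTHING about BSD asserted)

HONEST FRAMING (cell `bsd-print-cfram`, HOME `run/shared/lean/pub/bsd-print-cfram/`): no named fact, no
axiom, no `sorry`; THREE `@[conjecture]` inputs (summit-side obligations, as in companions I/VI),
two of which are DISCHARGED in the sequel, and one theorem; regime T and the leaf stay OPEN;
beyond-print theorem: NO.

SETTING. A `3`-frame `(K, 𝔭, W', C)` of `W` (`K = ℚ(√−3)`), `r_an(W) = 1`, anticyclotomic `κ` with
topological generator `γ`, WITHOUT the `ℚ₃`-binders (A𝔭)₃ (regime T: `W(ℚ₃)[3] ≠ 0` or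
`W'(ℚ₃)[3] ≠ 0`; the statements are typed for ALL frames and specialise to the N ∪ V ones, where
`d₀ = 1` and `ñ = n`). Displayed instead: the LOCAL finiteness binder `Finite (ker r_𝔭)` (companion
VII's `hfin𝔭`; p3 discharges it from the finiteness of `W(K_{∞,𝔭})[3^∞]`), a finite `T₀` of places
`v ∤ 3` with (Av)₃ only off `T₀`, the two defects `d₀ = globalControlDefectAtThree W K κ`
(`#H¹(Γ, W(K_∞)[3^∞])`) and `d(T₀) = controlDefectAtThree W K 𝔭 κ T₀` (now with a `𝔭`-part), and the
`3`-divisibility levels `ñ`, `ñ'` of the Mordell–Weil generators in `W(ℚ₃)`, `W'(ℚ₃)` MODULO TORSION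
(`∃ Q T, T torsion ∧ 3^ñ Q = loc P + T`, `∀ Q T, T torsion → 3^(ñ+1) Q ≠ loc P + T` — the exponent
of the torsion-modded index theorem `#Sel_str(W)[3^∞] = 3^ñ · #Ш(W)[3^∞]`,
`card_strictSelmerPInfty_eq_pow_mul_card_sha_modTorsion`).

* §1 the three inputs, `@[conjecture]`, nothing asserted: `RamifiedCMStrictTorsionAtThreeT W`
  ((R-tors)₃ᵀ: `X` has the shape `ord₃ f(0) = n₀`, `X[T]` finite — PROVED ⟸ GZK in the sequel),
  `RamifiedCMDefectControlAtThreeT W` ((R-ctrl)₃ᵀ♯: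
  `n₀ + log₃ #X[T] + log₃ d₀ = log₃ #Sel_str(W)[3^∞] + log₃ #Sel_str(W')[3^∞] + log₃ d(T₀)` under
  finiteness of `Sel_𝔭(K, W[3^∞])` — PROVED OUTRIGHT in the sequel from companion VII),
  `RamifiedCMEllipticUnitIndexAtThreeT W` ((R-EU)₃ᵀ:
  `n₀ + log₃ #X[T] + log₃ d₀ = ñ + ñ' + ord₃ #Ш_an(W) + ord₃ #Ш_an(W') + log₃ d(T₀)` — Perrin-Riou's
  leading-term law for the CM zeta element at the ramified prime `3`, TORSION-ALLOWING, both defects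
  displayed (on the left `d₀`, so no `ℤ`-subtraction); NOT in print; THE residual of regime T).
* §2 `bsdp_three_of_halvesT` — the three inputs + frame data + four named facts ⟹ `BSDp W 3`
  (companion VI's `bsdp_three_of_halvesV` with the torsion-modded index theorem for `W` and `W'`; the
  terms `log₃ d₀`, `log₃ d(T₀)` sit on the same sides of (R-ctrl)₃ᵀ♯ and (R-EU)₃ᵀ and cancel).
The discharges, the consumer from (R-EU)₃ᵀ alone, and the specialisation (R-EU)₃ᵀ ⟹ (R-EU)₃ᵛ are the
sequel `RamifiedStrictDescentAtThreeRegimeTDischarge.lean` (≤ 400-line rule).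

References: [GreenbergLNM1716] §3 Lemmas 3.1–3.3, p. 90, §4 Lemma 4.2, Prop. 4.13; [JetchevSkinnerWan2017]
§3.3 Prop. 3.3.7 (shape); [Castella2018] Def. 2.2, Thm. 2.3 (shape); [PerrinRiou1993AIF] §3.3.4–3.3.5;
[BurungaleKobayashiNakamuraOta2026] §1.4, Thm. 7.2, Assumption 3.1 (1) (shape; `p ≥ 5` / (A𝔭) there);
[Miller2011LMS] Def. 1.1; [Cassels1965ArithmeticVIII]; [GrossZagier1986] Thm. I.(7.3); [KuriharaPollack2007]
§1.5; tree: companions V–VII, `StrictSelmerIndexModTorsion{,Rat}`; HOME/PLAN.md v5 (δ); HOME/DOSSIER.md §37.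
-/

noncomputable section

open scoped Classical

open WeierstrassCurve NumberField IsDedekindDomain Field PowerSeries
  Literature.NumberTheory.EllipticCurves
  Literature.NumberTheory.EllipticCurves.GreenbergSelmer
  Literature.NumberTheory.EllipticCurves.Rank1Residual
  Literature.NumberTheory.GaloisRepresentations
  Summit.BirchSwinnertonDyer.Rank1Residual
  Summit.BirchSwinnertonDyer.Rank1Residual.Additive
  Summit.BirchSwinnertonDyer.Rank1Residual.X11b
  Summit.BirchSwinnertonDyer.Rank1Residual.X11b.AcSelmer
  Summit.BirchSwinnertonDyer.BirchSwinnertonDyer.Theorems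

namespace Summit.BirchSwinnertonDyer.Rank1Residual.X12.O11

variable (W : WeierstrassCurve ℚ) [W.IsElliptic] [W.IsGloballyMinimal]

/-! ## §1 The three regime-T inputs (all `@[conjecture]`; nothing asserted)

Binders (all three): a `3`-frame `(K, 𝔭, W', C)` of `W`, `r_an(W) = 1`, anticyclotomic `κ` with
topological generator `γ`, FINITENESS of `ker r_𝔭` (`Finite (localKer κ.kerSubgroup (W_K[3^∞]) 𝔭)`),
a finite set `T₀` of places `v ∤ 3` of `K` and (Av)₃ OFF `T₀`; for (R-ctrl)₃ᵀ♯ also finiteness of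
`Sel_𝔭(K, W[3^∞])`; for (R-EU)₃ᵀ also the generator data `P, ñ, P', ñ'` with levels MODULO TORSION. -/

/-- **(R-tors)₃ᵀ TYPED (nothing asserted)**: at a `3`-framed pair of analytic rank one, for
anticyclotomic `κ` with generator `γ`, granted finiteness of `ker r_𝔭` and (Av)₃ off a finite `T₀` of
places `v ∤ 3` — NO (A𝔭)₃ —: `X = XAc (W_K) 3 κ 𝔭 ∅ γ` has the shape `ord₃ f(0) = n₀` for some `n₀`
and `X[T]` is finite. Companion VI's (R-tors)₃ᵛ with the `ℚ₃`-binders replaced by the local finiteness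
binder. In analytic rank one it FOLLOWS FROM GZK (sequel, `ramifiedCMStrictTorsionAtThreeT_of_GZK`);
typed as an input; nothing asserted. [cite: BurungaleKobayashiNakamuraOta2026, Prop. 3.7 (2) (arXiv:2608.06879 pp. 19–20; `p ≥ 3`; claim; preprint; shape only)]
[cite: Castella2018, Def. 2.2 and Thm. 2.3 (arXiv:1704.06608 p. 5) (shape only)] -/
@[conjecture] def RamifiedCMStrictTorsionAtThreeT : Prop :=
  ∀ (K : Type) [Field K] [NumberField K] (𝔭 : HeightOneSpectrum (𝓞 K))
    (W' : WeierstrassCurve ℚ) [W'.IsElliptic] [W'.IsGloballyMinimal] (C : VariableChange ℚ),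
    IsFrameThree W K 𝔭 W' C → W.analyticRank = 1 →
    ∀ (κ : ZpExtension K 3), κ.IsAnticyclotomic →
      ∀ (γ : absoluteGaloisGroup K) [Fact (κ.IsTopGenerator γ)],
        Finite (localKer κ.kerSubgroup ((W.baseChange K).geomPrimaryTorsion 3) 𝔭) →
        ∀ (T₀ : Finset (HeightOneSpectrum (𝓞 K))), (∀ v ∈ T₀, ((3 : ℕ) : 𝓞 K) ∉ v.asIdeal) →
        (∀ v : HeightOneSpectrum (𝓞 K), v ∉ T₀ → ((3 : ℕ) : 𝓞 K) ∉ v.asIdeal →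
          v.asIdeal.ramificationIdx (𝓞 ℚ) = 1 → v.asIdeal.inertiaDeg (𝓞 ℚ) = 1 →
          (W.baseChange K).HasGoodReductionAt v ∨
            ∀ R : ((W.baseChange K).baseChange (v.adicCompletion K)).toAffine.Point,
              (3 : ℕ) • R = 0 → R = 0) →
        (∃ n₀ : ℕ, AcSelmer.XAc.HasCharValuationAt (W.baseChange K) 3 κ 𝔭 ∅ γ n₀) ∧
          Finite {x : AcSelmer.XAc (W.baseChange K) 3 κ 𝔭 ∅ γ //
            (PowerSeries.X : IwasawaAlgebra 3) • x = 0}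

/-- **(R-ctrl)₃ᵀ♯ TYPED (nothing asserted): TORSION-ALLOWING bottom-layer control at the ramified prime
`3`, BOTH defects displayed.** Same binders plus finiteness of `Sel_𝔭(K, W[3^∞])` (at a rank-one
frame a consequence of GZK): whenever `X` has the shape `ord₃ f(0) = n₀` with `X[T]` finite,
  `n₀ + log₃ #X[T] + log₃ d₀ = log₃ #Sel_str(W/ℚ)[3^∞] + log₃ #Sel_str(W'/ℚ)[3^∞] + log₃ d(T₀)`,
`d₀ = globalControlDefectAtThree W K κ` (`#H¹(Γ, W(K_∞)[3^∞])`), `d(T₀) = controlDefectAtThree W K 𝔭 κ T₀`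
(with its `𝔭`-part). PROVED OUTRIGHT in the sequel (`ramifiedCMDefectControlAtThreeT_holds`, from
companion VII's `#Sel^γ · d₀ = #Sel_str · #Sel_str' · d(T₀)` and Greenberg's Lemma 4.2); typed as an
input so that the consumer's shape is companion VI's. [cite: GreenbergLNM1716, §3 Lemmas 3.1–3.3, p. 90, §4 Lemma 4.2 and Prop. 4.13]
[cite: JetchevSkinnerWan2017, §3.3 Prop. 3.3.7 (the finite global/local factors at 𝔭; shape only)] -/
@[conjecture] def RamifiedCMDefectControlAtThreeT : Prop :=
  ∀ (K : Type) [Field K] [NumberField K] (𝔭 : HeightOneSpectrum (𝓞 K))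
    (W' : WeierstrassCurve ℚ) [W'.IsElliptic] [W'.IsGloballyMinimal] (C : VariableChange ℚ),
    IsFrameThree W K 𝔭 W' C → W.analyticRank = 1 →
    ∀ (κ : ZpExtension K 3), κ.IsAnticyclotomic →
      ∀ (γ : absoluteGaloisGroup K) [Fact (κ.IsTopGenerator γ)],
        Finite (localKer κ.kerSubgroup ((W.baseChange K).geomPrimaryTorsion 3) 𝔭) →
        ∀ (T₀ : Finset (HeightOneSpectrum (𝓞 K))), (∀ v ∈ T₀, ((3 : ℕ) : 𝓞 K) ∉ v.asIdeal) →
        (∀ v : HeightOneSpectrum (𝓞 K), v ∉ T₀ → ((3 : ℕ) : 𝓞 K) ∉ v.asIdeal →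
          v.asIdeal.ramificationIdx (𝓞 ℚ) = 1 → v.asIdeal.inertiaDeg (𝓞 ℚ) = 1 →
          (W.baseChange K).HasGoodReductionAt v ∨
            ∀ R : ((W.baseChange K).baseChange (v.adicCompletion K)).toAffine.Point,
              (3 : ℕ) • R = 0 → R = 0) →
        Finite (selmerAcBase (W.baseChange K) 3 𝔭 ∅) →
        ∀ (n₀ : ℕ), AcSelmer.XAc.HasCharValuationAt (W.baseChange K) 3 κ 𝔭 ∅ γ n₀ →
          Finite {x : AcSelmer.XAc (W.baseChange K) 3 κ 𝔭 ∅ γ //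
            (PowerSeries.X : IwasawaAlgebra 3) • x = 0} →
          (n₀ : ℤ) + padicValNat 3 (Nat.card {x : AcSelmer.XAc (W.baseChange K) 3 κ 𝔭 ∅ γ //
              (PowerSeries.X : IwasawaAlgebra 3) • x = 0}) +
              padicValNat 3 (globalControlDefectAtThree W K κ) =
            padicValNat 3 (Nat.card ↥(strictSelmerPInfty W 3)) +
              padicValNat 3 (Nat.card ↥(strictSelmerPInfty W' 3)) +
              padicValNat 3 (controlDefectAtThree W K 𝔭 κ T₀)

/-- **(R-EU)₃ᵀ TYPED (THE residual of regime T; NOT in print; nothing asserted): the TORSION-ALLOWING,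
defect-corrected elliptic-unit index formula at the ramified prime `3`, analytic rank one.** Companion
VI's (R-EU)₃ᵛ with the `ℚ₃`-binders (A𝔭)₃ DROPPED, the local finiteness binder `Finite (ker r_𝔭)`
displayed, the generators' levels taken MODULO TORSION (`ñ`, `ñ'`), and the global defect on the left:
whenever `X` has the shape `ord₃ f(0) = n₀` with `X[T]` finite,
  `n₀ + log₃ #X[T] + log₃ d₀ = ñ + ñ' + ord₃ #Ш_an(W) + ord₃ #Ш_an(W') + log₃ d(T₀)`.
At an N ∪ V frame `d₀ = 1` and `ñ = n` (sequel: (R-EU)₃ᵀ ⟹ (R-EU)₃ᵛ ⟹ (R-EU)₃), so this ONE law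
serves the whole `@3` crux; on regime T it is what a `3`-adic Gross–Zagier / explicit reciprocity law
at the additive, residually REDUCIBLE-with-rational-kernel prime `3` would prove — none is in print
([BKNO] §1.4 «report elsewhere»; their Assumption 3.1 (1) = (A𝔭) excludes exactly these members; JSW17
Prop. 3.3.7's finite factors are the shape of `d₀`, `d(T₀)`). Given (R-ctrl)₃ᵀ♯ (a theorem) and the
torsion-modded index theorem it is, member by member, exactly what `BSDp W 3` needs (§2). LABEL:
CONSTRUCTION / OPEN; nothing asserted.
[cite: PerrinRiou1993AIF, §3.3.4–3.3.5 (pp. 976–977: the conjectural leading-term formula)]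
[cite: BurungaleKobayashiNakamuraOta2026, §1.4, Thm. 7.2 and Assumption 3.1 (1) (arXiv:2608.06879 pp. 8, 16, 41) (claim; preprint; shape only)]
[cite: JetchevSkinnerWan2017, §3.3 Prop. 3.3.7 (arXiv:1512.06894 p. 12; the finite factors; shape only)]
[cite: GrossZagier1986, Thm. I.(7.3) (rationality of #Ш_an)] [cite: GreenbergLNM1716, §3 Lemma 3.1 and §4 Prop. 4.13 (the two defects)] -/
@[conjecture] def RamifiedCMEllipticUnitIndexAtThreeT : Prop :=
  ∀ (K : Type) [Field K] [NumberField K] (𝔭 : HeightOneSpectrum (𝓞 K))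
    (W' : WeierstrassCurve ℚ) [W'.IsElliptic] [W'.IsGloballyMinimal] (C : VariableChange ℚ),
    IsFrameThree W K 𝔭 W' C → W.analyticRank = 1 →
    ∀ (κ : ZpExtension K 3), κ.IsAnticyclotomic →
      ∀ (γ : absoluteGaloisGroup K) [Fact (κ.IsTopGenerator γ)]
        (P : W.toAffine.Point) (n : ℕ) (P' : W'.toAffine.Point) (n' : ℕ),
        ¬ IsOfFinAddOrder P →
        (∀ R : W.toAffine.Point, ∃ (k : ℤ) (T : W.toAffine.Point), IsOfFinAddOrder T ∧ R = k • P + T) →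
        (∃ Q T : (W.baseChange ℚ_[3]).toAffine.Point, IsOfFinAddOrder T ∧
          (3 : ℕ) ^ n • Q = W.toPadicPoint 3 P + T) →
        (∀ Q T : (W.baseChange ℚ_[3]).toAffine.Point, IsOfFinAddOrder T →
          (3 : ℕ) ^ (n + 1) • Q ≠ W.toPadicPoint 3 P + T) →
        ¬ IsOfFinAddOrder P' →
        (∀ R : W'.toAffine.Point, ∃ (k : ℤ) (T : W'.toAffine.Point),
          IsOfFinAddOrder T ∧ R = k • P' + T) →
        (∃ Q T : (W'.baseChange ℚ_[3]).toAffine.Point, IsOfFinAddOrder T ∧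
          (3 : ℕ) ^ n' • Q = W'.toPadicPoint 3 P' + T) →
        (∀ Q T : (W'.baseChange ℚ_[3]).toAffine.Point, IsOfFinAddOrder T →
          (3 : ℕ) ^ (n' + 1) • Q ≠ W'.toPadicPoint 3 P' + T) →
        Finite (localKer κ.kerSubgroup ((W.baseChange K).geomPrimaryTorsion 3) 𝔭) →
        ∀ (T₀ : Finset (HeightOneSpectrum (𝓞 K))), (∀ v ∈ T₀, ((3 : ℕ) : 𝓞 K) ∉ v.asIdeal) →
        (∀ v : HeightOneSpectrum (𝓞 K), v ∉ T₀ → ((3 : ℕ) : 𝓞 K) ∉ v.asIdeal →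
          v.asIdeal.ramificationIdx (𝓞 ℚ) = 1 → v.asIdeal.inertiaDeg (𝓞 ℚ) = 1 →
          (W.baseChange K).HasGoodReductionAt v ∨
            ∀ R : ((W.baseChange K).baseChange (v.adicCompletion K)).toAffine.Point,
              (3 : ℕ) • R = 0 → R = 0) →
        ∀ (q q' : ℚ), shaAn W = (q : ℂ) → shaAn W' = (q' : ℂ) →
        ∀ (n₀ : ℕ), AcSelmer.XAc.HasCharValuationAt (W.baseChange K) 3 κ 𝔭 ∅ γ n₀ →
          Finite {x : AcSelmer.XAc (W.baseChange K) 3 κ 𝔭 ∅ γ //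
            (PowerSeries.X : IwasawaAlgebra 3) • x = 0} →
          (n₀ : ℤ) + padicValNat 3 (Nat.card {x : AcSelmer.XAc (W.baseChange K) 3 κ 𝔭 ∅ γ //
              (PowerSeries.X : IwasawaAlgebra 3) • x = 0}) +
              padicValNat 3 (globalControlDefectAtThree W K κ) =
            (n : ℤ) + n' + padicValRat 3 q + padicValRat 3 q' +
              padicValNat 3 (controlDefectAtThree W K 𝔭 κ T₀)

/-! ## §2 PROVED consumer: the three inputs at a `3`-frame (any regime) give `BSD(W, 3)` -/

section Consumer

variable {W}
variable {K : Type} [Field K] [NumberField K] {𝔭 : HeightOneSpectrum (𝓞 K)}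
  {W' : WeierstrassCurve ℚ} [W'.IsElliptic] [W'.IsGloballyMinimal] {C : VariableChange ℚ}
  {κ : ZpExtension K 3} {P : W.toAffine.Point} {n : ℕ} {P' : W'.toAffine.Point} {n' : ℕ}

/-- **(R-tors)₃ᵀ ∧ (R-ctrl)₃ᵀ♯ ∧ (R-EU)₃ᵀ ⟹ `BSD(W, 3)`** at a `3`-framed pair `(W, W')` of analytic
rank one, ANY regime: frame, anticyclotomic `κ` with generator `γ`, generators `P`, `P'` with their
`3`-divisibility levels MODULO TORSION (`hdiv`/`hndiv`, `hdiv'`/`hndiv'`), finiteness of `ker r_𝔭`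
(`hfin𝔭`), a finite `T₀` of places `v ∤ 3` with (Av)₃ off `T₀` (`hT₀`, `hv`), and the named facts
Cassels (`hCassels`), Gross–Zagier I.(7.3) (`hGZ`), GZK (`hGZK`), modularity (`hmod`). PROOF =
companion VI's `bsdp_three_of_halvesV` with the TORSION-MODDED index theorem
(`padicValNat_card_strictSelmerPInfty_eq_modTorsion`, no `E(ℚ₃)[3] = 0` needed) for `W` and `W'`;
`Sel_𝔭(K, W[3^∞])` is finite by GZK + (D♮)₃; the defects `log₃ d₀`, `log₃ d(T₀)` sit on the same sides
of (R-ctrl)₃ᵀ♯ and (R-EU)₃ᵀ and cancel; Cassels along `W ∼ W'` finishes. CONDITIONAL on the three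
typed inputs; nothing booked. [cite: Cassels1965ArithmeticVIII] [cite: MilneADT2006, Thm. I.7.3]
[cite: GrossZagier1986, Thm. I.(7.3)] [cite: Miller2011LMS, §1 and Def. 1.1] [cite: KuriharaPollack2007, §1.5 (p. 361)] -/
theorem bsdp_three_of_halvesT (hmod : hasEntireLFunction_rat) (hGZ : GrossZagier1986_thm_I_7_3)
    (hGZK : rank_eq_analyticRank_of_analyticRank_le_one) (hCassels : bsdRHS_eq_of_isIsogenous)
    (h1 : RamifiedCMStrictTorsionAtThreeT W) (h2 : RamifiedCMDefectControlAtThreeT W)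
    (h3 : RamifiedCMEllipticUnitIndexAtThreeT W)
    (hF : IsFrameThree W K 𝔭 W' C) (hr : W.analyticRank = 1)
    (hκ : κ.IsAnticyclotomic) (γ : absoluteGaloisGroup K) [Fact (κ.IsTopGenerator γ)]
    (hP : ¬ IsOfFinAddOrder P)
    (hgen : ∀ R : W.toAffine.Point, ∃ (k : ℤ) (T : W.toAffine.Point),
      IsOfFinAddOrder T ∧ R = k • P + T)
    (hdiv : ∃ Q T : (W.baseChange ℚ_[3]).toAffine.Point, IsOfFinAddOrder T ∧
      (3 : ℕ) ^ n • Q = W.toPadicPoint 3 P + T)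
    (hndiv : ∀ Q T : (W.baseChange ℚ_[3]).toAffine.Point, IsOfFinAddOrder T →
      (3 : ℕ) ^ (n + 1) • Q ≠ W.toPadicPoint 3 P + T)
    (hP' : ¬ IsOfFinAddOrder P')
    (hgen' : ∀ R : W'.toAffine.Point, ∃ (k : ℤ) (T : W'.toAffine.Point),
      IsOfFinAddOrder T ∧ R = k • P' + T)
    (hdiv' : ∃ Q T : (W'.baseChange ℚ_[3]).toAffine.Point, IsOfFinAddOrder T ∧
      (3 : ℕ) ^ n' • Q = W'.toPadicPoint 3 P' + T)
    (hndiv' : ∀ Q T : (W'.baseChange ℚ_[3]).toAffine.Point, IsOfFinAddOrder T →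
      (3 : ℕ) ^ (n' + 1) • Q ≠ W'.toPadicPoint 3 P' + T)
    (hfin𝔭 : Finite (localKer κ.kerSubgroup ((W.baseChange K).geomPrimaryTorsion 3) 𝔭))
    (T₀ : Finset (HeightOneSpectrum (𝓞 K))) (hT₀ : ∀ v ∈ T₀, ((3 : ℕ) : 𝓞 K) ∉ v.asIdeal)
    (hv : ∀ v : HeightOneSpectrum (𝓞 K), v ∉ T₀ → ((3 : ℕ) : 𝓞 K) ∉ v.asIdeal →
      v.asIdeal.ramificationIdx (𝓞 ℚ) = 1 → v.asIdeal.inertiaDeg (𝓞 ℚ) = 1 →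
      (W.baseChange K).HasGoodReductionAt v ∨
        ∀ R : ((W.baseChange K).baseChange (v.adicCompletion K)).toAffine.Point,
          (3 : ℕ) • R = 0 → R = 0) :
    BSDp W 3 := by
  have hiso : IsIsogenous W W' := isIsogenous_of_isFrameThree hF
  -- ranks and finiteness of `Ш` for `W` and for the isogenous `W'` (GZK)
  obtain ⟨hrank, hfin⟩ := hGZK W hr.le
  haveI : Finite W.sha := hfin
  have hr' : W'.analyticRank = 1 := by rw [← analyticRank_eq_of_isIsogenous' hiso, hr]
  obtain ⟨-, hfin'⟩ := hGZK W' hr'.le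
  haveI : Finite W'.sha := hfin'
  -- `Sel_𝔭(K, W[3^∞])` is finite (GZK for both members + the twist count (D♮)₃)
  have hfinW : Finite ↥(strictSelmerPInfty W 3) :=
    RamifiedSevenEllipticUnits.finite_strictSelmerPInfty_of_GZK hGZK W 3 hr
  have hfinW' : Finite ↥(strictSelmerPInfty W' 3) :=
    RamifiedSevenEllipticUnits.finite_strictSelmerPInfty_of_GZK hGZK W' 3 hr'
  have hbase : Finite (selmerAcBase (W.baseChange K) 3 𝔭 ∅) := by
    refine Nat.finite_of_card_ne_zero ?_
    rw [natCard_selmerAcBase_frameThree_eq_mul W hF]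
    exact mul_ne_zero Nat.card_pos.ne' Nat.card_pos.ne'
  -- `#Ш_an ∈ ℚ^×` for both
  obtain ⟨q, hq⟩ := Disegni2020.exists_rat_shaAn_eq_of_analyticRank_eq_one hGZ hGZK W hr
  obtain ⟨q', hq'⟩ := Disegni2020.exists_rat_shaAn_eq_of_analyticRank_eq_one hGZ hGZK W' hr'
  have hq0 : q ≠ 0 := by
    rintro rfl
    exact AdditivePotMult.shaAn_ne_zero W hmod (by rw [hq, Rat.cast_zero])
  have hq0' : q' ≠ 0 := by
    rintro rfl
    exact AdditivePotMult.shaAn_ne_zero W' hmod (by rw [hq', Rat.cast_zero])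
  -- the three inputs
  obtain ⟨⟨n₀, hchar⟩, hfinT⟩ := h1 K 𝔭 W' C hF hr κ hκ γ hfin𝔭 T₀ hT₀ hv
  have hctrl := h2 K 𝔭 W' C hF hr κ hκ γ hfin𝔭 T₀ hT₀ hv hbase n₀ hchar hfinT
  have heu := h3 K 𝔭 W' C hF hr κ hκ γ P n P' n' hP hgen hdiv hndiv hP' hgen' hdiv' hndiv' hfin𝔭
    T₀ hT₀ hv q q' hq hq' n₀ hchar hfinT
  -- the TORSION-MODDED index theorem, for `W` and for `W'`
  haveI : Finite (AddCommGroup.primaryComponent W.sha 3) := inferInstance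
  haveI : Finite (AddCommGroup.primaryComponent W'.sha 3) := inferInstance
  have hI := padicValNat_card_strictSelmerPInfty_eq_modTorsion W 3 hP hgen hdiv hndiv
  have hI' := padicValNat_card_strictSelmerPInfty_eq_modTorsion W' 3 hP' hgen' hdiv' hndiv'
  -- sum identity: `ord₃ #Ш(W)(3) + ord₃ #Ш(W')(3) = ord₃ q + ord₃ q'` (both defects cancel)
  have hsum : (padicValNat 3 (Nat.card (AddCommGroup.primaryComponent W.sha 3)) : ℤ) +
      padicValNat 3 (Nat.card (AddCommGroup.primaryComponent W'.sha 3)) =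
      padicValRat 3 q + padicValRat 3 q' := by
    rw [hI, hI', Nat.cast_add, Nat.cast_add] at hctrl
    linarith
  -- Cassels along `W ∼ W'`: `#Ш_an(W) · #Ш(W') = #Ш_an(W') · #Ш(W)`
  obtain ⟨-, hRHS⟩ := hCassels W W' hiso hfin
  have hlead_eq : W.leadingLCoeff = W'.leadingLCoeff := leadingLCoeff_eq_of_isIsogenous' hiso
  have h1W := Wuthrich2014.shaAn_mul_bsdRHS W
  have h1W' := Wuthrich2014.shaAn_mul_bsdRHS W'
  have hshaQ : (W.shaOrder : ℚ) ≠ 0 := by exact_mod_cast (W.shaOrder_pos hfin).ne'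
  have hshaQ' : (W'.shaOrder : ℚ) ≠ 0 := by exact_mod_cast (W'.shaOrder_pos hfin').ne'
  have hRHS0 : (W.bsdRHS : ℂ) ≠ 0 := by exact_mod_cast W.bsdRHS_ne_zero hfin
  have hkey : (q : ℂ) * (W'.shaOrder : ℂ) = (q' : ℂ) * (W.shaOrder : ℂ) := by
    rw [hq] at h1W
    rw [hq', hRHS, ← hlead_eq] at h1W'
    have h3 : ((q : ℂ) * (W'.shaOrder : ℂ)) * (W.bsdRHS : ℂ) =
        ((q' : ℂ) * (W.shaOrder : ℂ)) * (W.bsdRHS : ℂ) := by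
      calc ((q : ℂ) * (W'.shaOrder : ℂ)) * (W.bsdRHS : ℂ)
          = ((q : ℂ) * (W.bsdRHS : ℂ)) * (W'.shaOrder : ℂ) := by ring
        _ = (W.leadingLCoeff * (W.shaOrder : ℂ)) * (W'.shaOrder : ℂ) := by rw [h1W]
        _ = (W.leadingLCoeff * (W'.shaOrder : ℂ)) * (W.shaOrder : ℂ) := by ring
        _ = ((q' : ℂ) * (W.bsdRHS : ℂ)) * (W.shaOrder : ℂ) := by rw [h1W']
        _ = ((q' : ℂ) * (W.shaOrder : ℂ)) * (W.bsdRHS : ℂ) := by ring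
    exact mul_right_cancel₀ hRHS0 h3
  have hkeyQ : q * (W'.shaOrder : ℚ) = q' * (W.shaOrder : ℚ) := by exact_mod_cast hkey
  have hval : padicValRat 3 q + (padicValNat 3 W'.shaOrder : ℤ) =
      padicValRat 3 q' + (padicValNat 3 W.shaOrder : ℤ) := by
    have h := congrArg (padicValRat 3) hkeyQ
    rwa [padicValRat.mul hq0 hshaQ', padicValRat.mul hq0' hshaQ, padicValRat.of_nat,
      padicValRat.of_nat] at h
  refine ⟨hrank, inferInstance, q, hq, ?_⟩
  rw [padicValNat_card_addPrimaryComponent, padicValNat_card_addPrimaryComponent] at hsum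
  rw [padicValNat_card_addPrimaryComponent]
  have e1 : W.shaOrder = Nat.card W.sha := rfl
  have e2 : W'.shaOrder = Nat.card W'.sha := rfl
  rw [e1, e2] at hval
  linarith

end Consumer

end Summit.BirchSwinnertonDyer.Rank1Residual.X12.O11

end
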